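import Summits.AtomisticToContinuum.Crystallization.Theorems.HullExactificationCascadeRobustBarlowTemplateDefs

/-!
# `injective_scaleRatio` and `injective_farVertex` for line `registered` (crux `RobustBarlowTemplate`, stmt-AtomisticToContinuum-12088)

Two elementary estimates toward the registered stub `develop_injective` (the STAR ESTIMATE
`injective_starApprox`): the local similarity data `(A_p, l_p)` of `LocSim s Ψ` at ADJACENT sites
of the ideal stacking are compatible.

## Statements
* `injective_scaleRatio`: if `X` is a contact of `v` (`dist X v = 1`) then the scales satisfy
  `19 l_X ≤ 21 l_v`.  Proof: the `v`-clause at `q := X` gives `dist (Ψ X) (Ψ v) ≤ l_v + l_v/20`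
  (`‖l_v • A (X - v)‖ = l_v` by the isometry), the `X`-clause at `q := v` gives
  `l_X ≤ l_X/20 + dist (Ψ v) (Ψ X)`.
* `injective_farVertex`: for the far end `v̄ = P + Q - v` of the diagonal of a quarter octahedron
  (with `P, Q` common contacts of `v` and `X`, and `X` a contact of `v`, `v̄`), the affine model
  `σ_v z = Ψ v + l_v • A (z - v)` at `v` predicts `Ψ v̄` up to `l_X/5 + l_v/10`.  Proof: both
  `σ_v` and `σ_X` are affine, so `σ(v̄) = σ(P) + σ(Q) - σ(v)` for both; compare `Ψ v̄` with
  `σ_X v̄` (`X`-clause), and `σ_X` with `σ_v` at `P`, `Q` (both clauses) and at `v` (`X`-clause,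
  `σ_v v = Ψ v`).

## Contents
`injective_scaleRatio`, `injective_farVertex` (registered sub-goals; no helpers).
-/

noncomputable section

namespace Summit.AtomisticToContinuum.Crystallization.Theorems.HullExactificationCascadeRobustBarlowTemplate

open Literature.MathematicalPhysics.StatisticalMechanics

/-- Euclidean `3`-space. -/
local notation "E3" => EuclideanSpace ℝ (Fin 3)

/-- SUB-GOAL `injective_scaleRatio` (registered; toward `develop_injective`): the `LocSim` scales at
two sites at distance `1` are comparable, `19 l_X ≤ 21 l_v`. -/
theorem injective_scaleRatio : ∀ (s : ℤ → ℤ) (Ψ : E3 → E3) (v X : E3), v ∈ idealStacking s → X ∈ idealStacking s → dist X v = 1 → ∀ (A Ax : E3 →ₗᵢ[ℝ] E3) (l lx : ℝ), 0 < l → 0 < lx → (∀ q ∈ idealStacking s, dist q v ≤ 1 → dist (Ψ q) (Ψ v + l • A (q - v)) ≤ 1 / 20 * l) → (∀ q ∈ idealStacking s, dist q X ≤ 1 → dist (Ψ q) (Ψ X + lx • Ax (q - X)) ≤ 1 / 20 * lx) → 19 * lx ≤ 21 * l := by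
  intro s Ψ v X hv hX hXv A Ax l lx hl hlx hcv hcX
  have h1 := hcv X hX hXv.le
  have h2 := hcX v hv (by rw [dist_comm]; exact hXv.le)
  have nA : ‖l • A (X - v)‖ = l := by
    rw [norm_smul, LinearIsometry.norm_map, ← dist_eq_norm, hXv, Real.norm_eq_abs, abs_of_pos hl,
      mul_one]
  have nAx : ‖lx • Ax (v - X)‖ = lx := by
    rw [norm_smul, LinearIsometry.norm_map, ← dist_eq_norm, dist_comm, hXv, Real.norm_eq_abs,
      abs_of_pos hlx, mul_one]
  rw [dist_eq_norm] at h1 h2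
  have eq : lx • Ax (v - X) =
      -(Ψ v - (Ψ X + lx • Ax (v - X))) - (Ψ X - (Ψ v + l • A (X - v))) - l • A (X - v) := by abel
  set t1 := Ψ v - (Ψ X + lx • Ax (v - X))
  set t2 := Ψ X - (Ψ v + l • A (X - v))
  have i1 := norm_sub_le (-t1 - t2) (l • A (X - v))
  have i2 := norm_sub_le (-t1) t2
  rw [norm_neg] at i2
  rw [← eq, nAx, nA] at i1
  linarith

/-- SUB-GOAL `injective_farVertex` (registered; toward `develop_injective`): the affine model at `v`
predicts `Ψ` at the far diagonal end `v̄ = P + Q - v` of a quarter octahedron up to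
`l_X/5 + l_v/10`. -/
theorem injective_farVertex : ∀ (s : ℤ → ℤ) (Ψ : E3 → E3) (v vb P Q X : E3), v ∈ idealStacking s → vb ∈ idealStacking s → P ∈ idealStacking s → Q ∈ idealStacking s → X ∈ idealStacking s → dist P v ≤ 1 → dist Q v ≤ 1 → dist X v ≤ 1 → dist v X ≤ 1 → dist P X ≤ 1 → dist Q X ≤ 1 → dist vb X ≤ 1 → vb = P + Q - v → ∀ (A Ax : E3 →ₗᵢ[ℝ] E3) (l lx : ℝ), 0 < l → 0 < lx → (∀ q ∈ idealStacking s, dist q v ≤ 1 → dist (Ψ q) (Ψ v + l • A (q - v)) ≤ 1 / 20 * l) → (∀ q ∈ idealStacking s, dist q X ≤ 1 → dist (Ψ q) (Ψ X + lx • Ax (q - X)) ≤ 1 / 20 * lx) → dist (Ψ vb) (Ψ v + l • A (vb - v)) ≤ 1 / 5 * lx + 1 / 10 * l := by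
  intro s Ψ v vb P Q X hv hvb hP hQ hX hPv hQv _hXv hvX hPX hQX hvbX hvbdef A Ax l lx _hl _hlx hcv hcX
  have h1 := hcX vb hvb hvbX
  have h2 := hcX P hP hPX
  have h3 := hcX Q hQ hQX
  have h4 := hcX v hv hvX
  have h5 := hcv P hP hPv
  have h6 := hcv Q hQ hQv
  rw [dist_eq_norm] at h1 h2 h3 h4 h5 h6 ⊢
  rw [← norm_neg, neg_sub] at h2 h3
  have eq : Ψ vb - (Ψ v + l • A (vb - v)) =
      (Ψ vb - (Ψ X + lx • Ax (vb - X))) + ((Ψ X + lx • Ax (P - X)) - Ψ P) +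
        (Ψ P - (Ψ v + l • A (P - v))) + ((Ψ X + lx • Ax (Q - X)) - Ψ Q) +
        (Ψ Q - (Ψ v + l • A (Q - v))) + (Ψ v - (Ψ X + lx • Ax (v - X))) := by
    subst hvbdef
    have e1 : P + Q - v - v = (P - v) + (Q - v) := by abel
    have e2 : P + Q - v - X = (P - X) + (Q - X) - (v - X) := by abel
    rw [e1, e2]
    simp only [map_add, map_sub, smul_add, smul_sub]
    abel
  rw [eq]
  set t1 := Ψ vb - (Ψ X + lx • Ax (vb - X))
  set t2 := (Ψ X + lx • Ax (P - X)) - Ψ P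
  set t3 := Ψ P - (Ψ v + l • A (P - v))
  set t4 := (Ψ X + lx • Ax (Q - X)) - Ψ Q
  set t5 := Ψ Q - (Ψ v + l • A (Q - v))
  set t6 := Ψ v - (Ψ X + lx • Ax (v - X))
  have i6 := norm_add_le (t1 + t2 + t3 + t4 + t5) t6
  have i5 := norm_add_le (t1 + t2 + t3 + t4) t5
  have i4 := norm_add_le (t1 + t2 + t3) t4
  have i3 := norm_add_le (t1 + t2) t3
  have i2 := norm_add_le t1 t2
  linarith

end Summit.AtomisticToContinuum.Crystallization.Theorems.HullExactificationCascadeRobustBarlowTemplate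

end
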